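import Summits.BirchSwinnertonDyer.BirchSwinnertonDyer.Theorems.PrintCf2RamifiedOffTYZQFormOddForestPair
import Summits.BirchSwinnertonDyer.BirchSwinnertonDyer.Theorems.PrintCf2RamifiedOffTYZQFormMonsky
import HarnessLib

/-!
# Route `PrintCf2`, crux stmt-BirchSwinnertonDyer-20509 `RamifiedOffTYZOfFacts` — the Q-form identity (★) for `n ≡ 7 (mod 8)`: MONSKY'S MATRIX
# (cell `bsd-print-cf2`, LEAD of 20509 g8, line `offtyz-v7`, cycle 9; kernel helpers `--supports stmt-BirchSwinnertonDyer-20509`)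

The bridge from the odd forest layer (`…QFormOddForest`, `…QFormOddForestPair`) to MONSKY'S odd matrix `M_n = monskyMatrixOdd p` (Heath-Brown
1994, appendix) for `n = p₁⋯p_k ≡ 3 (mod 4)`, i.e. `Σ (−1/pᵢ)₊ = 1` — the case where g6's symmetric form `bigN aᵀ z z z = J·M_n + (rank one)`
(`…QFormMonsky`, valid for `n ≡ 1 (mod 4)`) is not available:

* `bigN_legendreT_zero_eq` — for `Σ y = 1` the column sums of `A` vanish, so the doubled matrix WITHOUT root weights is
  **`Ñ := bigN aᵀ univ y z 0 = [[D₋₁, A],[Aᵀ, D₂]]`** (`aᵀ s t = A_{ts}`, `y = ((−1/pᵢ)₊)`, `z = ((2/pᵢ)₊)`);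
* `conj_monskyMatrixOdd_eq_bigN` — **`Ñ = L · M_n · R`** with the unimodular block matrices `L = [[1,1],[y𝟙ᵀ, y𝟙ᵀ+1]]`, `R = [[1,1],[1,0]]`
  (row/column operations + Monsky's (31) `Aᵀ = A + D₋₁ + yyᵀ` + `𝟙ᵀA = 0`); hence `det M_n = det Ñ` (`det_monskyMatrixOdd_eq_det_bigN_zero`)
  and `ker M_n = R·ker Ñ` (`monskyMatrixOdd_mulVec_swap_eq_zero_iff`);
* for `n ≡ 7 (mod 8)` (`Σ y = 1`, `Σ z = 0`; `det Ñ = 0` by parity): Monsky's kernel sum `κ_n = Σ_{v ∈ ker M_n} v` (g5's `QForm.kappa`) reads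
  **`κ_n(inr t) = adj(Ñ)_{(inl t)(inl t)}`**, **`κ_n(inl t) + κ_n(inr t) = adj(Ñ)_{(inr t)(inr t)}`** (`kerSum_monsky_inr_eq_adjugate_seven`,
  `kerSum_monsky_inl_add_inr_eq_adjugate_seven`), and therefore, by the odd forest layer,
  **(★b)₇** `κ_n(inr t) = Σ_{B ∋ t, ∏_B pᵢ ≡ 5 (8)} κ_t^{aᵀ}(B) · det Ñ_{univ∖B}` and
  **(★a)₇** `κ_n(inl s)+κ_n(inr s)+κ_n(inl t)+κ_n(inr t) = Σ_{B ∋ s,t, ∏_B pᵢ ≡ 5 (8)} (κ_s^{aᵀ}+κ_t^{aᵀ})(B) · det Ñ_{univ∖B}`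
  (`kerSum_monsky_inr_eq_sum_mod_eight_seven`, `kerSum_monsky_four_eq_sum_mod_eight_seven`).
The literal re-indexing to g5's `QForm.Omega / kappaA / kappaB` (`det Ñ_{univ∖B} = det M_{n/d_B} = coblockWeight`, `κ_t^{aᵀ}(B) = blockRho`) is
the next file. Pure linear algebra over `𝔽₂` + quadratic reciprocity; no `sorry`. BSD is not proved by any of this; no class is closed.

References: [cite: HeathBrown1994SelmerCongruentII, Appendix (Monsky), typescript p. 39 L10 – p. 40 L31]; [cite: Chaiken1982, §2];
[cite: Smith2016CongruentDensity, §2].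
-/

namespace Summit.BirchSwinnertonDyer.PrintCf2.QFormForest

open Matrix Finset Literature.LinearAlgebra.Matrix Literature.Combinatorics.Enumerative
open Literature.NumberTheory.EllipticCurves.Smith2016

section MonskyOdd

open Literature.NumberTheory.EllipticCurves.HeathBrown1994 Literature.NumberTheory.EllipticCurves.MonskySelmerParity

variable {k : ℕ} (p : Fin k → ℕ) (hp : ∀ i, (p i).Prime) (hp2 : ∀ i, p i ≠ 2) (hinj : Function.Injective p)

/-- Over `𝔽₂` every matrix is its own negative: `X + X = 0`. [folklore] -/
theorem matrix_add_self_eq_zero {m n : Type*} (X : Matrix m n (ZMod 2)) : X + X = 0 := by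
  ext i j
  exact CharTwo.add_self_eq_zero _

include hp hp2 hinj in
/-- **Column sums of Monsky's `A` vanish when `Σ (−1/pᵢ)₊ = 1`** (`n ≡ 3 (mod 4)`): `Σ_{l ≠ i} A_{li} = A_{ii}`, i.e. `𝟙ᵀ A = 0`
(Monsky: "`r(A)` will be `u` or `0` according as `D ≡ 1` or `3 (mod 4)`").
[cite: HeathBrown1994SelmerCongruentII, Appendix (Monsky), typescript p. 39 L49 – p. 40 L1] -/
theorem sum_erase_legendreMatrix_col_of_odd (h4 : ∑ i, addLegendreSym (-1) (p i) = 1) (i : Fin k) :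
    ∑ l ∈ univ.erase i, legendreMatrix p l i = legendreMatrix p i i := by
  have h := congrFun (one_vecMul_legendreMatrix p hp hp2 hinj) i
  rw [h4, CharTwo.add_self_eq_zero, zero_smul, vecMul] at h
  change ∑ l, (1 : ZMod 2) * legendreMatrix p l i = 0 at h
  simp only [one_mul] at h
  rw [← add_sum_erase univ _ (mem_univ i)] at h
  have h2 : ∀ u v : ZMod 2, u + v = 0 → v = u := by decide
  exact h2 _ _ h

include hp hp2 hinj in
/-- `𝟙ᵀ A = 0` as a vector identity when `Σ (−1/pᵢ)₊ = 1`. [cite: HeathBrown1994SelmerCongruentII, Appendix (Monsky), typescript p. 39 L49 – p. 40 L1] -/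
theorem one_vecMul_legendreMatrix_of_odd (h4 : ∑ i, addLegendreSym (-1) (p i) = 1) :
    (1 : Fin k → ZMod 2) ᵥ* legendreMatrix p = 0 := by
  rw [one_vecMul_legendreMatrix p hp hp2 hinj, h4, CharTwo.add_self_eq_zero, zero_smul]

include hp hp2 hinj in
/-- **The doubled matrix without root weights of the transposed Legendre weights**, for `Σ (−1/pᵢ)₊ = 1`:
`bigN aᵀ univ y z 0 = [[D₋₁, A],[Aᵀ, D₂]]` (the Laplacian block `lapIn aᵀ univ 0` has the column sums of `A` on its diagonal, `= A_ii`).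
[cite: HeathBrown1994SelmerCongruentII, Appendix (Monsky), typescript p. 39 L13–L41] [cite: Chaiken1982, §2] -/
theorem bigN_legendreT_zero_eq (h4 : ∑ i, addLegendreSym (-1) (p i) = 1) :
    bigN (fun i j => legendreMatrix p j i) univ (fun i => addLegendreSym (-1) (p i)) (fun i => addLegendreSym 2 (p i)) 0 =
      fromBlocks (legendreDiagonal p (-1)) (legendreMatrix p) (legendreMatrix p)ᵀ (legendreDiagonal p 2) := by
  have hcol := sum_erase_legendreMatrix_col_of_odd p hp hp2 hinj h4
  ext (i | i) (j | j)
  · rw [bigN_inl_inl, fromBlocks_apply₁₁, legendreDiagonal, diagonal_apply]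
    simp
  · rw [bigN_inl_inr, lapIn_apply, fromBlocks_apply₁₂, Pi.zero_apply, zero_add]
    simp only [mem_univ, and_self, if_true]
    by_cases hij : i = j
    · subst hij; rw [if_pos rfl, hcol]
    · rw [if_neg (Ne.symm hij)]
  · rw [bigN_inr_inl, lapIn_apply, fromBlocks_apply₂₁, transpose_apply, Pi.zero_apply, zero_add]
    simp only [mem_univ, and_self, if_true]
    by_cases hij : i = j
    · subst hij; rw [if_pos rfl, hcol]
    · rw [if_neg hij]
  · rw [bigN_inr_inr, fromBlocks_apply₂₂, legendreDiagonal, diagonal_apply]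
    simp

include hp hp2 hinj in
/-- **`[[D₋₁, A],[Aᵀ, D₂]] = L · M_n · R`** for `Σ (−1/pᵢ)₊ = 1`, with `L = [[1, 1],[y𝟙ᵀ, y𝟙ᵀ + 1]]`, `R = [[1, 1],[1, 0]]` (`y = ((−1/pᵢ)₊)`):
block row/column operations on Monsky's `M = [[A + D₂, D₂],[D₂, A + D₋₂]]` using `D₋₂ = D₋₁ + D₂`, Monsky's (31) `Aᵀ = A + D₋₁ + y yᵀ` and
`𝟙ᵀ A = 0`. [cite: HeathBrown1994SelmerCongruentII, Appendix (Monsky), typescript p. 39 L27–L41] -/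
theorem conj_monskyMatrixOdd_eq_bigN (h4 : ∑ i, addLegendreSym (-1) (p i) = 1) :
    fromBlocks (1 : Matrix (Fin k) (Fin k) (ZMod 2)) 1
        (vecMulVec (fun i => addLegendreSym (-1) (p i)) 1) (vecMulVec (fun i => addLegendreSym (-1) (p i)) 1 + 1) *
      monskyMatrixOdd p *
      fromBlocks (1 : Matrix (Fin k) (Fin k) (ZMod 2)) 1 1 0 =
      bigN (fun i j => legendreMatrix p j i) univ (fun i => addLegendreSym (-1) (p i)) (fun i => addLegendreSym 2 (p i)) 0 := by
  set A := legendreMatrix p with hA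
  set Dy := legendreDiagonal p (-1) with hDy
  set Dz := legendreDiagonal p 2 with hDz
  set yv : Fin k → ZMod 2 := fun i => addLegendreSym (-1) (p i) with hyv
  set Y : Matrix (Fin k) (Fin k) (ZMod 2) := vecMulVec yv 1 with hY
  have hYA : Y * A = 0 := by
    rw [hY, vecMulVec_mul, hA, one_vecMul_legendreMatrix_of_odd p hp hp2 hinj h4]
    ext i j; simp [vecMulVec_apply]
  have hYDy : Y * Dy = vecMulVec yv yv := by
    rw [hY, vecMulVec_mul, hDy, one_vecMul_legendreDiagonal]
  have hAT : Aᵀ = vecMulVec yv yv + (A + Dy) := by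
    have h := legendreMatrix_add_transpose p hp hp2 hinj
    rw [← hA, ← hDy] at h
    have h2 : Aᵀ = A + (A + Aᵀ) := by rw [← add_assoc, matrix_add_self_eq_zero, zero_add]
    rw [h2, h]
    abel
  have hm2 : legendreDiagonal p (-2) = Dy + Dz := legendreDiagonal_neg_two p hp hp2
  rw [bigN_legendreT_zero_eq p hp hp2 hinj h4, monskyMatrixOdd, ← hA, ← hDz, hm2, Matrix.mul_assoc, fromBlocks_multiply,
    fromBlocks_multiply, fromBlocks_inj]
  simp only [Matrix.mul_one, Matrix.mul_zero, Matrix.one_mul, add_zero]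
  refine ⟨?_, ?_, ?_, ?_⟩
  · -- `A + Dz + Dz + (Dz + (A + (Dy + Dz))) = Dy`
    rw [show A + Dz + Dz + (Dz + (A + (Dy + Dz))) = Dy + (A + A) + (Dz + Dz) + (Dz + Dz) by abel,
      matrix_add_self_eq_zero, matrix_add_self_eq_zero, add_zero, add_zero, add_zero]
  · -- `A + Dz + Dz = A`
    rw [add_assoc, matrix_add_self_eq_zero, add_zero]
  · -- `Y (A + Dz + Dz) + (Y + 1)(Dz + (A + (Dy + Dz))) = Aᵀ`
    rw [show A + Dz + Dz = A by rw [add_assoc, matrix_add_self_eq_zero, add_zero],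
      show Dz + (A + (Dy + Dz)) = A + Dy + (Dz + Dz) by abel, matrix_add_self_eq_zero, add_zero, add_mul, Matrix.one_mul,
      Matrix.mul_add, hYA, hYDy, zero_add, zero_add, hAT, ← transpose_transpose (vecMulVec yv yv + (A + Dy)), ← hAT,
      transpose_transpose]
  · -- `Y (A + Dz) + (Y + 1) Dz = Dz`
    rw [Matrix.mul_add, hYA, zero_add, add_mul, Matrix.one_mul, ← add_assoc, matrix_add_self_eq_zero, zero_add]

include hp hp2 hinj in
/-- **`det M_n = det [[D₋₁, A],[Aᵀ, D₂]]`** for `Σ (−1/pᵢ)₊ = 1` (the conjugating matrices are unimodular).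
[cite: HeathBrown1994SelmerCongruentII, Appendix (Monsky), typescript p. 39 L27–L33] -/
theorem det_monskyMatrixOdd_eq_det_bigN_zero (h4 : ∑ i, addLegendreSym (-1) (p i) = 1) :
    (monskyMatrixOdd p).det =
      (bigN (fun i j => legendreMatrix p j i) univ (fun i => addLegendreSym (-1) (p i)) (fun i => addLegendreSym 2 (p i)) 0).det := by
  rw [← conj_monskyMatrixOdd_eq_bigN p hp hp2 hinj h4, det_mul, det_mul, det_fromBlocks_one₁₁, det_fromBlocks_one₁₁, Matrix.mul_one,
    add_sub_cancel_left, det_one, one_mul, Matrix.one_mul, zero_sub, det_neg, det_one, mul_one]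
  have h1 : (-1 : ZMod 2) = 1 := by decide
  rw [h1, one_pow, mul_one]

/-- `[[1+Y, 1],[Y, 1]] · [[1, 1],[Y, Y+1]] = 1` over `𝔽₂`. [folklore] -/
theorem fromBlocks_left_inverse (Y : Matrix (Fin k) (Fin k) (ZMod 2)) :
    fromBlocks (1 + Y) 1 Y 1 * fromBlocks (1 : Matrix (Fin k) (Fin k) (ZMod 2)) 1 Y (Y + 1) = 1 := by
  rw [fromBlocks_multiply, ← fromBlocks_one, fromBlocks_inj]
  simp only [Matrix.mul_one, Matrix.one_mul, add_mul]
  refine ⟨?_, ?_, ?_, ?_⟩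
  · rw [add_assoc, matrix_add_self_eq_zero, add_zero]
  · rw [show (1 : Matrix (Fin k) (Fin k) (ZMod 2)) + Y + (Y + 1) = (1 + 1) + (Y + Y) by abel, matrix_add_self_eq_zero,
      matrix_add_self_eq_zero, add_zero]
  · exact matrix_add_self_eq_zero Y
  · rw [← add_assoc, matrix_add_self_eq_zero, zero_add]

/-- `[[1,1],[1,0]] · (v; w) = (v + w; v)`. [folklore] -/
theorem fromBlocks_swap_mulVec (v w : Fin k → ZMod 2) :
    fromBlocks (1 : Matrix (Fin k) (Fin k) (ZMod 2)) 1 1 0 *ᵥ Sum.elim v w = Sum.elim (v + w) v := by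
  rw [fromBlocks_mulVec, Sum.elim_comp_inl, Sum.elim_comp_inr]
  simp only [one_mulVec, zero_mulVec, add_zero]

include hp hp2 hinj in
/-- **`ker M_n = R · ker Ñ`** for `Σ (−1/pᵢ)₊ = 1`: `M_n (v + w; v) = 0 ⟺ Ñ (v; w) = 0` with `Ñ = bigN aᵀ univ y z 0`
(from `Ñ = L M_n R`, `L` invertible). [cite: HeathBrown1994SelmerCongruentII, Appendix (Monsky), typescript p. 39 L27 – p. 40 L24] -/
theorem monskyMatrixOdd_mulVec_swap_eq_zero_iff (h4 : ∑ i, addLegendreSym (-1) (p i) = 1) (v w : Fin k → ZMod 2) :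
    monskyMatrixOdd p *ᵥ Sum.elim (v + w) v = 0 ↔
      bigN (fun i j => legendreMatrix p j i) univ (fun i => addLegendreSym (-1) (p i)) (fun i => addLegendreSym 2 (p i)) 0 *ᵥ
        Sum.elim v w = 0 := by
  set Y : Matrix (Fin k) (Fin k) (ZMod 2) := vecMulVec (fun i => addLegendreSym (-1) (p i)) 1 with hY
  have hconj := conj_monskyMatrixOdd_eq_bigN p hp hp2 hinj h4
  rw [← hY] at hconj
  rw [← hconj, ← mulVec_mulVec, ← mulVec_mulVec, fromBlocks_swap_mulVec]
  constructor
  · intro h; rw [h, mulVec_zero]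
  · intro h
    have h2 := congrArg (fun x => fromBlocks (1 + Y) 1 Y 1 *ᵥ x) h
    rw [mulVec_mulVec, fromBlocks_left_inverse, one_mulVec, mulVec_zero] at h2
    exact h2

include hp hp2 in
/-- `∏ pᵢ ≡ 7 (mod 8)` ⟹ `Σ (−1/pᵢ)₊ = 1` and `Σ (2/pᵢ)₊ = 0`. [cite: HeathBrown1994SelmerCongruentII, Appendix (Monsky), typescript p. 39 L36–L37] -/
theorem sums_of_prod_mod_eight_seven (h7 : (∏ i, p i) % 8 = 7) :
    ∑ i, addLegendreSym (-1) (p i) = 1 ∧ ∑ i, addLegendreSym 2 (p i) = 0 := by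
  rw [sum_addLegendreSym_neg_one_eq p hp hp2, sum_addLegendreSym_two_eq p hp hp2, if_neg (by omega), if_pos (by omega)]
  exact ⟨rfl, rfl⟩

/-- Re-indexing a sum over `𝔽₂^{k ⊔ k}` by the linear change of variables `(v; w) ↦ (v + w; v)` (a bijection with inverse
`(u; v) ↦ (v; u + v)`). [folklore] -/
theorem sum_reindex_swapAdd {β : Type*} [AddCommMonoid β] (F : (Fin k ⊕ Fin k → ZMod 2) → β) :
    ∑ x : Fin k ⊕ Fin k → ZMod 2, F (Sum.elim (x ∘ Sum.inl + x ∘ Sum.inr) (x ∘ Sum.inl)) = ∑ v, F v := by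
  refine Fintype.sum_equiv ⟨fun x => Sum.elim (x ∘ Sum.inl + x ∘ Sum.inr) (x ∘ Sum.inl),
    fun u => Sum.elim (u ∘ Sum.inr) (u ∘ Sum.inl + u ∘ Sum.inr), ?_, ?_⟩ _ _ (fun x => rfl)
  · have hab : ∀ a b : ZMod 2, a + b + a = b := by decide
    intro x
    ext (i | i)
    · simp
    · simp only [Sum.elim_comp_inl, Sum.elim_comp_inr, Sum.elim_inr, Pi.add_apply, Function.comp_apply]
      exact hab _ _
  · have hab : ∀ a b : ZMod 2, b + (a + b) = a := by decide
    intro u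
    ext (i | i)
    · simp only [Sum.elim_comp_inl, Sum.elim_comp_inr, Sum.elim_inl, Pi.add_apply, Function.comp_apply]
      exact hab _ _
    · simp

include hp hp2 hinj in
/-- **Monsky's kernel sum through `Ñ`** (`n ≡ 7 (mod 8)`): `κ_n(inr t) = adj(Ñ)_{(inl t)(inl t)}` — the kernel of `M_n` is the image of
`ker Ñ` under `(v; w) ↦ (v + w; v)`, `Ñ` is symmetric and singular (parity), and the kernel sum of a singular symmetric matrix over `𝔽₂` is the
diagonal of its adjugate. [cite: HeathBrown1994SelmerCongruentII, Appendix (Monsky), typescript p. 39 L27 – p. 40 L31] [cite: HornJohnson2013, §0.8.2] -/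
theorem kerSum_monsky_inr_eq_adjugate_seven (h7 : (∏ i, p i) % 8 = 7) (t : Fin k) :
    (∑ v : Fin k ⊕ Fin k → ZMod 2, if monskyMatrixOdd p *ᵥ v = 0 then v else 0) (Sum.inr t) =
      (bigN (fun i j => legendreMatrix p j i) univ (fun i => addLegendreSym (-1) (p i)) (fun i => addLegendreSym 2 (p i)) 0).adjugate
        (Sum.inl t) (Sum.inl t) := by
  obtain ⟨h4, hz⟩ := sums_of_prod_mod_eight_seven p hp hp2 h7
  set N := bigN (fun i j => legendreMatrix p j i) univ (fun i => addLegendreSym (-1) (p i)) (fun i => addLegendreSym 2 (p i)) 0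
    with hN
  have hrec := hrec_legendreT p hp hp2 hinj
  have hdet : N.det = 0 :=
    det_bigN_zero_root_eq_zero _ _ _ univ hrec (by rw [h4, hz]; exact one_ne_zero)
  rw [← kerSum_apply_eq_adjugate N (bigN_transpose _ _ _ _ _) hdet,
    ← sum_reindex_swapAdd (fun v => if monskyMatrixOdd p *ᵥ v = 0 then v else 0), Finset.sum_apply, Finset.sum_apply]
  refine sum_congr rfl fun x _ => ?_
  have hiff : monskyMatrixOdd p *ᵥ Sum.elim (x ∘ Sum.inl + x ∘ Sum.inr) (x ∘ Sum.inl) = 0 ↔ N *ᵥ x = 0 := by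
    rw [monskyMatrixOdd_mulVec_swap_eq_zero_iff p hp hp2 hinj h4, hN]
    have hxe : Sum.elim (x ∘ Sum.inl) (x ∘ Sum.inr) = x := by ext (i | i) <;> rfl
    rw [hxe]
  by_cases h : N *ᵥ x = 0
  · rw [if_pos (hiff.mpr h), if_pos h, Sum.elim_inr, Function.comp_apply]
  · rw [if_neg (fun h' => h (hiff.mp h')), if_neg h, Pi.zero_apply, Pi.zero_apply]

include hp hp2 hinj in
/-- **Monsky's kernel sum through `Ñ`** (`n ≡ 7 (mod 8)`): `κ_n(inl t) + κ_n(inr t) = adj(Ñ)_{(inr t)(inr t)}`.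
[cite: HeathBrown1994SelmerCongruentII, Appendix (Monsky), typescript p. 39 L27 – p. 40 L31] [cite: HornJohnson2013, §0.8.2] -/
theorem kerSum_monsky_inl_add_inr_eq_adjugate_seven (h7 : (∏ i, p i) % 8 = 7) (t : Fin k) :
    (∑ v : Fin k ⊕ Fin k → ZMod 2, if monskyMatrixOdd p *ᵥ v = 0 then v else 0) (Sum.inl t) +
      (∑ v : Fin k ⊕ Fin k → ZMod 2, if monskyMatrixOdd p *ᵥ v = 0 then v else 0) (Sum.inr t) =
      (bigN (fun i j => legendreMatrix p j i) univ (fun i => addLegendreSym (-1) (p i)) (fun i => addLegendreSym 2 (p i)) 0).adjugate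
        (Sum.inr t) (Sum.inr t) := by
  obtain ⟨h4, hz⟩ := sums_of_prod_mod_eight_seven p hp hp2 h7
  set N := bigN (fun i j => legendreMatrix p j i) univ (fun i => addLegendreSym (-1) (p i)) (fun i => addLegendreSym 2 (p i)) 0
    with hN
  have hrec := hrec_legendreT p hp hp2 hinj
  have hdet : N.det = 0 :=
    det_bigN_zero_root_eq_zero _ _ _ univ hrec (by rw [h4, hz]; exact one_ne_zero)
  rw [← kerSum_apply_eq_adjugate N (bigN_transpose _ _ _ _ _) hdet,
    ← sum_reindex_swapAdd (fun v => if monskyMatrixOdd p *ᵥ v = 0 then v else 0), Finset.sum_apply, Finset.sum_apply,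
    Finset.sum_apply, ← sum_add_distrib]
  refine sum_congr rfl fun x _ => ?_
  have hiff : monskyMatrixOdd p *ᵥ Sum.elim (x ∘ Sum.inl + x ∘ Sum.inr) (x ∘ Sum.inl) = 0 ↔ N *ᵥ x = 0 := by
    rw [monskyMatrixOdd_mulVec_swap_eq_zero_iff p hp hp2 hinj h4, hN]
    have hxe : Sum.elim (x ∘ Sum.inl) (x ∘ Sum.inr) = x := by ext (i | i) <;> rfl
    rw [hxe]
  have hab : ∀ a b : ZMod 2, a + b + a = b := by decide
  by_cases h : N *ᵥ x = 0
  · rw [if_pos (hiff.mpr h), if_pos h]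
    simp only [Sum.elim_inl, Sum.elim_inr, Pi.add_apply, Function.comp_apply]
    exact hab _ _
  · rw [if_neg (fun h' => h (hiff.mp h')), if_neg h, Pi.zero_apply, Pi.zero_apply, add_zero]

include hp hp2 hinj in
/-- **(★b)₇ for Monsky's matrix, in forest language**: for `n = ∏ pᵢ ≡ 7 (mod 8)` and every `t`,
`κ_n(inr t) = Σ_{B ∋ t, Σ_B y = 0, Σ_B z = 1} κ_t^{aᵀ}(B) · det bigN aᵀ (univ∖B) y z 0` (`κ_n(inr t) = kappaB p t`; on admissible blocks
`κ_t^{aᵀ}(B) = blockRho p B t` and `det bigN aᵀ(univ∖B) y z 0 = det M_{n/d_B} = coblockWeight p B`, next file).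
[cite: HeathBrown1994SelmerCongruentII, Appendix (Monsky), typescript p. 39 L27–L41] [cite: Chaiken1982, §2] -/
theorem kerSum_monsky_inr_eq_sum_admissible_seven (h7 : (∏ i, p i) % 8 = 7) (t : Fin k) :
    (∑ v : Fin k ⊕ Fin k → ZMod 2, if monskyMatrixOdd p *ᵥ v = 0 then v else 0) (Sum.inr t) =
      ∑ B ∈ (univ : Finset (Fin k)).powerset.filter
          (fun B => t ∈ B ∧ (∑ i ∈ B, addLegendreSym (-1) (p i) = 0 ∧ ∑ i ∈ B, addLegendreSym 2 (p i) = 1)),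
        treeDet (fun i j => legendreMatrix p j i) B t *
          (bigN (fun i j => legendreMatrix p j i) (univ \ B) (fun i => addLegendreSym (-1) (p i))
            (fun i => addLegendreSym 2 (p i)) 0).det := by
  obtain ⟨h4, hz⟩ := sums_of_prod_mod_eight_seven p hp hp2 h7
  have hrec := hrec_legendreT p hp hp2 hinj
  rw [kerSum_monsky_inr_eq_adjugate_seven p hp hp2 hinj h7 t,
    adjugate_bigN_zero_root_inl_inl_eq_sum_admissible _ _ _ hrec h4 hz (mem_univ t),
    sum_powerset_filter_mem_and_eq _ (mem_univ t)]
  refine sum_congr rfl fun B₀ _ => ?_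
  rw [erase_sdiff_eq_sdiff_insert]

include hp hp2 hinj in
/-- **(★a)₇ for Monsky's matrix, in forest language**: for `n = ∏ pᵢ ≡ 7 (mod 8)` and `s ≠ t`,
`κ_n(inl s) + κ_n(inr s) + κ_n(inl t) + κ_n(inr t) = Σ_{B ∋ s,t, Σ_B y = 0, Σ_B z = 1} (κ_s^{aᵀ}(B) + κ_t^{aᵀ}(B)) · det bigN aᵀ(univ∖B) y z 0`.
[cite: HeathBrown1994SelmerCongruentII, Appendix (Monsky), typescript p. 39 L27–L41] [cite: Chaiken1982, §2] -/
theorem kerSum_monsky_four_eq_sum_admissible_seven (h7 : (∏ i, p i) % 8 = 7) {s t : Fin k} (hst : s ≠ t) :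
    (∑ v : Fin k ⊕ Fin k → ZMod 2, if monskyMatrixOdd p *ᵥ v = 0 then v else 0) (Sum.inl s) +
      (∑ v : Fin k ⊕ Fin k → ZMod 2, if monskyMatrixOdd p *ᵥ v = 0 then v else 0) (Sum.inr s) +
      ((∑ v : Fin k ⊕ Fin k → ZMod 2, if monskyMatrixOdd p *ᵥ v = 0 then v else 0) (Sum.inl t) +
        (∑ v : Fin k ⊕ Fin k → ZMod 2, if monskyMatrixOdd p *ᵥ v = 0 then v else 0) (Sum.inr t)) =
      ∑ B ∈ (univ : Finset (Fin k)).powerset.filter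
          (fun B => s ∈ B ∧ t ∈ B ∧ (∑ i ∈ B, addLegendreSym (-1) (p i) = 0 ∧ ∑ i ∈ B, addLegendreSym 2 (p i) = 1)),
        (treeDet (fun i j => legendreMatrix p j i) B s + treeDet (fun i j => legendreMatrix p j i) B t) *
          (bigN (fun i j => legendreMatrix p j i) (univ \ B) (fun i => addLegendreSym (-1) (p i))
            (fun i => addLegendreSym 2 (p i)) 0).det := by
  have hrec := hrec_legendreT p hp hp2 hinj
  rw [kerSum_monsky_inl_add_inr_eq_adjugate_seven p hp hp2 hinj h7 s, kerSum_monsky_inl_add_inr_eq_adjugate_seven p hp hp2 hinj h7 t]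
  exact adjugate_bigN_zero_root_inr_inr_add_eq_sum_admissible _ _ _ hrec (mem_univ s) (mem_univ t) hst

include hp hp2 hinj in
/-- **(★b)₇ for Monsky's matrix with the `mod 8` filter**: `κ_n(inr t) = Σ_{B ∋ t, ∏_B pᵢ ≡ 5 (8)} κ_t^{aᵀ}(B) · det bigN aᵀ(univ∖B) y z 0`.
[cite: HeathBrown1994SelmerCongruentII, Appendix (Monsky), typescript p. 39 L27–L41] [cite: Chaiken1982, §2] -/
theorem kerSum_monsky_inr_eq_sum_mod_eight_seven (h7 : (∏ i, p i) % 8 = 7) (t : Fin k) :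
    (∑ v : Fin k ⊕ Fin k → ZMod 2, if monskyMatrixOdd p *ᵥ v = 0 then v else 0) (Sum.inr t) =
      ∑ B ∈ (univ : Finset (Fin k)).powerset.filter (fun B => t ∈ B ∧ (∏ i ∈ B, p i) % 8 = 5),
        treeDet (fun i j => legendreMatrix p j i) B t *
          (bigN (fun i j => legendreMatrix p j i) (univ \ B) (fun i => addLegendreSym (-1) (p i))
            (fun i => addLegendreSym 2 (p i)) 0).det := by
  rw [kerSum_monsky_inr_eq_sum_admissible_seven p hp hp2 hinj h7 t]
  exact sum_congr (filter_congr fun B _ => by rw [admissible_iff_prod_mod_eight p hp hp2 B]) fun _ _ => rfl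

include hp hp2 hinj in
/-- **(★a)₇ for Monsky's matrix with the `mod 8` filter**: for `s ≠ t`,
`κ_n(inl s) + κ_n(inr s) + κ_n(inl t) + κ_n(inr t) = Σ_{B ∋ s,t, ∏_B pᵢ ≡ 5 (8)} (κ_s^{aᵀ} + κ_t^{aᵀ})(B) · det bigN aᵀ(univ∖B) y z 0`.
[cite: HeathBrown1994SelmerCongruentII, Appendix (Monsky), typescript p. 39 L27–L41] [cite: Chaiken1982, §2] -/
theorem kerSum_monsky_four_eq_sum_mod_eight_seven (h7 : (∏ i, p i) % 8 = 7) {s t : Fin k} (hst : s ≠ t) :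
    (∑ v : Fin k ⊕ Fin k → ZMod 2, if monskyMatrixOdd p *ᵥ v = 0 then v else 0) (Sum.inl s) +
      (∑ v : Fin k ⊕ Fin k → ZMod 2, if monskyMatrixOdd p *ᵥ v = 0 then v else 0) (Sum.inr s) +
      ((∑ v : Fin k ⊕ Fin k → ZMod 2, if monskyMatrixOdd p *ᵥ v = 0 then v else 0) (Sum.inl t) +
        (∑ v : Fin k ⊕ Fin k → ZMod 2, if monskyMatrixOdd p *ᵥ v = 0 then v else 0) (Sum.inr t)) =
      ∑ B ∈ (univ : Finset (Fin k)).powerset.filter (fun B => s ∈ B ∧ t ∈ B ∧ (∏ i ∈ B, p i) % 8 = 5),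
        (treeDet (fun i j => legendreMatrix p j i) B s + treeDet (fun i j => legendreMatrix p j i) B t) *
          (bigN (fun i j => legendreMatrix p j i) (univ \ B) (fun i => addLegendreSym (-1) (p i))
            (fun i => addLegendreSym 2 (p i)) 0).det := by
  rw [kerSum_monsky_four_eq_sum_admissible_seven p hp hp2 hinj h7 hst]
  exact sum_congr (filter_congr fun B _ => by rw [admissible_iff_prod_mod_eight p hp hp2 B]) fun _ _ => rfl

end MonskyOdd

end Summit.BirchSwinnertonDyer.PrintCf2.QFormForest
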